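/-
Copyright: the b2b-balaban T⁴-continuum CRUX team, row NE7b owner lineage `t4-ne7b-p1` (gen 114). Project licence.
-/
import Summits.QuantumFields.BalabanUV.T4Continuum.Spine.NE7b.LocalNemytskiiSup
import Summits.QuantumFields.BalabanUV.T4Continuum.Spine.NE7b.HardStepBranchDerivModulus

/-!
# THE INTERACTING CHART AT THE SMALL-FIELD BACKGROUND CONFIGURATION, IN THE SUP CURRENCY: under the letters of
# `…LocalNemytskiiSup.exists_smallField_branch` (any chart `T : ℓ^∞ ≃L F × K` reading `(Q, R)`, `‖T⁻¹y‖ ≤ N‖y‖`; `P : ℓ^∞ →L K`,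
# `‖P‖ ≤ C_P`; sitewise `u` with `u 0 = 0`, `|u′| ≤ λ`, `Lip u′ ≤ L`; `C_P·λ ≤ c < N⁻¹`), at every interior coarse field `w` the
# linearised constrained Euler–Lagrange system of the PERTURBED action AT the background `σ w`, `A(w) h = (Q h, R h + P((u′∘σ w)·h))`,
# is an equivalence with `‖A(w)⁻¹ z‖ ≤ (N⁻¹ − c)⁻¹‖z‖`, and `Dσ(w) = A(w)⁻¹ ∘ inl` — the two chart letters (`T`, `N`) the NEXT hard
# step reads, now for the interacting action, with the Nemytskii derivative family exported
# (row NE7b, node U5c; `…LocalNemytskiiSup` §2–§3 + HSCR `exists_branch_chart` + HSBD `hasFDerivAt_sliceBranch_of_chart` BY NAME; [folklore])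

Cell `pub-balaban`, sub-cell `t4`, spine estimate NE7b (`T4WeightBudget.RelWeightBound`; the cell's OWN estimate — NOT PRINTED
in [Bałaban 1983–89], NOT PROVED).  Crux-route work under `Spine/NE7b/` by the row OWNER (`t4-ne7b-p1` gen 114) under FREEZE
(0)'s crux-prover clause (FILING-CLAIM C-ne7bp1-g114-7); NOTHING of Bałaban's is named as a Lean object, valued or asserted; no
`T4Continuum/Support` leaf typed; no `def`, no notation; zero `sorry`.  Imports: the owner's (58) `…LocalNemytskiiSup` (v1.1; through it
HSCR, HSBD, Mathlib's `lp`) and (v1.1) leaf-03's `…HardStepBranchDerivModulus` (HSBDM; Mathlib only behind it).  A sibling rather than a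
v1.2 append of (58) because (58) is at the 400-line cap.

WHY (located).  (58) §6 delivers the background configuration `σ` and the size of `Dσ`; the hard-step ROAD (HSIS ∕ HSTT ∕ `…HardStep*`)
consumes at the next scale the CHART of the interacting action at the background: an equivalence reading `(Q, V″(σ w))` with an
inverse bound.  HSBD's `hasFDerivAt_sliceBranch_of_chart` already produces that equivalence inside (58) §6's proof (it is discarded
there); this file exports it, together with the Nemytskii derivative family `N′` (`N′φ h = (u′∘φ)·h`) so that `A(w)`'s action is
displayed: `A(w) h = (Q h, R h + P (N′(σ w) h))`.  Constant: `(N⁻¹ − c)⁻¹` — the free chart's `N` degraded by the perturbation letter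
`c ≥ C_P·sup|v″|`, uniformly in `w` and in the radius.

WHAT IS PROVED ([folklore]; `ℓ^∞ := lp (fun _ : ι => ℝ) ∞`, `ι` nonempty):
* **`exists_smallField_chart_at_background`** — `∃ N N′ σ`: `N φ i = u(φ i)`, `N′ φ h i = u′(φ i)·h i`, `HasFDerivAt N (N′φ) φ`; `σ 0 = 0`;
  (58) §4's branch letters (existence on `‖w‖ ≤ (N⁻¹ − c)r`, `Q(σ w) = w`, `R(σ w) + P(N(σ w)) = 0`, Lipschitz, uniqueness); and for
  every `‖w‖ < (N⁻¹ − c)r` an `A : ℓ^∞ ≃L F × K` with `A h = (Q h, R h + P (N′(σ w) h))`, **`‖A⁻¹ z‖ ≤ (N⁻¹ − c)⁻¹‖z‖`**,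
  **`HasFDerivAt σ (A⁻¹ ∘ inl) w`**.
* toy.
* §8 (v1.1, APPEND) THE FLUCTUATION COVARIANCE AT THE BACKGROUND `C(w) := A(w)⁻¹ ∘ inr : K →L ℓ^∞` — the OTHER column of the
  interacting chart's inverse (the first, `A(w)⁻¹ ∘ inl = Dσ(w)`, is the background response): abstract letters for any chart
  `A h = (Q h, S h)` (`fibre_letters`: `Q(A⁻¹(0,κ)) = 0`, `S(A⁻¹(0,κ)) = κ`, uniqueness; `symm_apply_eq_add`: `A⁻¹(v,κ) = A⁻¹(v,0) + A⁻¹(0,κ)`;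
  `norm_symm_inr_le`; `norm_coe_sub_coe_le`: `‖B − A‖ ≤ ‖S′ − S‖` for two charts on the same kept map; **`norm_symm_inr_sub_le`**:
  `‖A⁻¹(0,κ) − B⁻¹(0,κ)‖ ≤ N₁²‖S′ − S‖‖κ‖`, HSBDM `norm_symm_sub_symm_apply_le` BY NAME), the Nemytskii modulus from the displayed action
  (`norm_nemytskiiDeriv_sub_le`: `‖N′φ − N′ψ‖ ≤ L‖φ − ψ‖`), and the instance **`exists_fluctuation_covariance_at_background`**: under
  the hypotheses of `exists_smallField_chart_at_background`, a family `C : F → (K →L ℓ^∞)` with, at every interior `w`, `Q ∘ C(w) = 0`,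
  `R(C(w)κ) + P(N′(σ w)(C(w)κ)) = κ` (the fibre equation of the linearised interacting action AT the background), uniqueness of the fibre
  solution, **`‖C(w)κ‖ ≤ (N⁻¹ − c)⁻¹‖κ‖`**, `C(w) = A(w)⁻¹ ∘ inr` next to `Dσ(w) = A(w)⁻¹ ∘ inl`, and the background-dependence modulus
  **`‖C(w)κ − C(w′)κ‖ ≤ (N⁻¹ − c)⁻³·(C_P·L)·‖w − w′‖·‖κ‖`** on the interior ball.

NOT HERE (honest): the next hard step itself in a non-Hilbert currency (HSIS is Hilbert-typed — leaf-06's lane); the Gaussian-skeleton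
instance ((60) `…SupSmallFieldBackground` for the background; the interacting chart instance is one `obtain` away once wanted); values
for print's covariant objects ((A3), NC-NE7b-α UNRULED); anything of Bałaban's.  BY-NAME EFFECT ON THE WALL: NONE.  NE7b NOT PRINTED ∕
NOT PROVED; spine PROVED 0∕9; rung (B)+1 on a FINITE torus — NOT infinite volume, NOT the mass gap, NOT Clay.  HONEST DEPENDENCY:
continuum YM on T⁴ ⇐ BetaPertH ∧ nine spine estimates (0∕9 proved); BetaPertH ⇐ (D1) ∧ (D4) ∧ CAP+tail; G-an2-4 gates asym, D1 and NE2∕3∕4.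
-/

set_option autoImplicit false

noncomputable section

namespace Summit.QuantumFields.BalabanUV.T4Continuum.NE7b.SupInteractingChart

open Set Metric
open scoped ENNReal NNReal
open LocalNemytskiiSup (exists_nemytskii hasFDerivAt_transversal norm_fderiv_transversal_sub_le norm_linearisation_sub_le
  nontrivial_lp_infty)

variable {ι : Type*}

/-! ## §7. (v1.2, APPEND) The interacting chart at the background configuration: `‖A(w)⁻¹‖ ≤ (N⁻¹ − c)⁻¹`, `Dσ(w) = A(w)⁻¹ ∘ inl` -/

section InteractingChart

variable {F K : Type*} [NormedAddCommGroup F] [NormedSpace ℝ F] [NormedAddCommGroup K] [NormedSpace ℝ K]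

/-- **THE INTERACTING CHART AT THE BACKGROUND CONFIGURATION, IN THE SUP CURRENCY.**  Under §4's hypotheses: the Nemytskii map `N`
(`N φ i = u(φ i)`) with its derivative family `N′` (`N′ φ h i = u′(φ i)·h i`, `HasFDerivAt N (N′φ) φ`), the branch `σ` with §4's letters,
and at every interior `‖w‖ < (N⁻¹ − c)·r` an equivalence `A : ℓ^∞ ≃L F × K` reading the linearised constrained Euler–Lagrange system AT
`σ w` — `A h = (Q h, R h + P (N′(σ w) h))` — with `‖A⁻¹ z‖ ≤ (N⁻¹ − c)⁻¹‖z‖` and `HasFDerivAt σ (A⁻¹ ∘ inl) w`: the two chart letters of the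
next hard step for the interacting action, constant `(N⁻¹ − c)⁻¹` (HSBD `hasFDerivAt_sliceBranch_of_chart` BY NAME). [folklore] -/
theorem exists_smallField_chart_at_background [Nonempty ι] (Q : lp (fun _ : ι => ℝ) ∞ →L[ℝ] F)
    (R P : lp (fun _ : ι => ℝ) ∞ →L[ℝ] K)
    (T : lp (fun _ : ι => ℝ) ∞ ≃L[ℝ] F × K) (hT : ∀ h, T h = (Q h, R h)) {N c CP lam : ℝ≥0}
    (hN : ∀ y : F × K, ‖T.symm y‖ ≤ N * ‖y‖) (hP : ‖P‖ ≤ CP) (hc : CP * lam ≤ c) (hcN : c < N⁻¹)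
    {u u' : ℝ → ℝ} (hu : ∀ t, HasDerivAt u (u' t) t) (hu0 : u 0 = 0) (hlam : ∀ t, |u' t| ≤ lam) {L : ℝ} (hL0 : 0 ≤ L)
    (hL : ∀ s t, |u' s - u' t| ≤ L * |s - t|) {r : ℝ} (hr : 0 ≤ r) :
    ∃ (Nu : lp (fun _ : ι => ℝ) ∞ → lp (fun _ : ι => ℝ) ∞)
      (N' : lp (fun _ : ι => ℝ) ∞ → (lp (fun _ : ι => ℝ) ∞ →L[ℝ] lp (fun _ : ι => ℝ) ∞)) (σ : F → lp (fun _ : ι => ℝ) ∞),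
      (∀ (φ : lp (fun _ : ι => ℝ) ∞) (i : ι), Nu φ i = u (φ i)) ∧
      (∀ (φ h : lp (fun _ : ι => ℝ) ∞) (i : ι), N' φ h i = u' (φ i) * h i) ∧
      (∀ φ : lp (fun _ : ι => ℝ) ∞, HasFDerivAt Nu (N' φ) φ) ∧ σ 0 = 0 ∧
      (∀ w ∈ closedBall (0 : F) (((N : ℝ)⁻¹ - c) * r),
        σ w ∈ closedBall 0 r ∧ Q (σ w) = w ∧ R (σ w) + P (Nu (σ w)) = 0) ∧
      LipschitzOnWith (N⁻¹ - c)⁻¹ σ (closedBall (0 : F) (((N : ℝ)⁻¹ - c) * r)) ∧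
      (∀ φ ∈ closedBall (0 : lp (fun _ : ι => ℝ) ∞) r, R φ + P (Nu φ) = 0 → σ (Q φ) = φ) ∧
      (∀ w ∈ ball (0 : F) (((N : ℝ)⁻¹ - c) * r), ∃ A : lp (fun _ : ι => ℝ) ∞ ≃L[ℝ] F × K,
        (∀ h, A h = (Q h, R h + P (N' (σ w) h))) ∧
        (∀ z : F × K, ‖A.symm z‖ ≤ ((N : ℝ)⁻¹ - c)⁻¹ * ‖z‖) ∧
        HasFDerivAt σ ((A.symm : F × K →L[ℝ] lp (fun _ : ι => ℝ) ∞).comp (ContinuousLinearMap.inl ℝ F K)) w) := by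
  haveI : Nontrivial (lp (fun _ : ι => ℝ) ∞) := nontrivial_lp_infty
  obtain ⟨Nu, N', hNapp, hN'app, hNderiv, hN'norm, -⟩ :=
    exists_nemytskii (ι := ι) hu lam.coe_nonneg hlam hL0 hL
  have hN0 : Nu 0 = 0 := lp.ext (funext fun i => by rw [hNapp, lp.coeFn_zero, Pi.zero_apply, hu0])
  have hg0 : R 0 + P (Nu 0) = 0 := by rw [hN0, map_zero, map_zero, add_zero]
  have hc' : ∀ x : lp (fun _ : ι => ℝ) ∞, ‖P‖ * ‖N' x‖ ≤ c := fun x =>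
    (mul_le_mul hP (hN'norm x) (norm_nonneg _) CP.coe_nonneg).trans (by exact_mod_cast hc)
  have hgd : ∀ x ∈ closedBall (0 : lp (fun _ : ι => ℝ) ∞) r, DifferentiableAt ℝ (fun ψ => R ψ + P (Nu ψ)) x :=
    fun x _ => (hasFDerivAt_transversal R P (hNderiv x)).differentiableAt
  have hgc : ∀ x ∈ closedBall (0 : lp (fun _ : ι => ℝ) ∞) r, ‖fderiv ℝ (fun ψ => R ψ + P (Nu ψ)) x - R‖ ≤ c := fun x _ =>
    (norm_fderiv_transversal_sub_le R P (hNderiv x) le_rfl).trans (hc' x)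
  obtain ⟨σ, hσ0, hσ, hlip, huniq⟩ :=
    HardStepChartRadius.exists_branch_chart Q R T hT (δ₀ := 0) hr hN hcN hgd hgc
  rw [map_zero] at hσ0 hσ hlip
  have hΦd : ∀ x ∈ closedBall (0 : lp (fun _ : ι => ℝ) ∞) r,
      HasFDerivAt (fun ψ => (Q ψ, R ψ + P (Nu ψ))) (Q.prod (R + P.comp (N' x))) x := fun x _ =>
    Q.hasFDerivAt.prodMk (hasFDerivAt_transversal R P (hNderiv x))
  have hΦc : ∀ x ∈ closedBall (0 : lp (fun _ : ι => ℝ) ∞) r,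
      ‖Q.prod (R + P.comp (N' x)) - (T : lp (fun _ : ι => ℝ) ∞ →L[ℝ] F × K)‖ ≤ c := fun x _ =>
    (norm_linearisation_sub_le Q R P T hT le_rfl).trans (hc' x)
  have hσ' : ∀ w ∈ closedBall (0 : F) (((N : ℝ)⁻¹ - c) * r), σ w ∈ closedBall 0 r ∧
      ((fun ψ => (Q ψ, R ψ + P (Nu ψ))) (σ w)).1 = w ∧ ((fun ψ => (Q ψ, R ψ + P (Nu ψ))) (σ w)).2 = 0 := fun w hw => by
    obtain ⟨h1, h2, h3⟩ := hσ w hw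
    refine ⟨h1, h2, ?_⟩
    show R (σ w) + P (Nu (σ w)) = 0
    rw [h3, hg0]
  refine ⟨Nu, N', σ, hNapp, hN'app, hNderiv, hσ0, fun w hw => ?_, hlip, fun φ hφ hEL => huniq φ hφ (by rw [hEL, hg0]),
    fun w hw => ?_⟩
  · obtain ⟨h1, h2, h3⟩ := hσ w hw
    exact ⟨h1, h2, by rw [h3, hg0]⟩
  · obtain ⟨A, hAeq, hAinv, hd, -⟩ := HardStepBranchDeriv.hasFDerivAt_sliceBranch_of_chart T hN hcN hΦd hΦc hσ'
      hlip.continuousOn hw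
    refine ⟨A, fun h => ?_, hAinv, hd⟩
    rw [← ContinuousLinearEquiv.coe_coe, hAeq, ContinuousLinearMap.prod_apply, add_apply,
      ContinuousLinearMap.comp_apply]

end InteractingChart

/-! ## Toy -/

/-- Toy: the constant's shape — free chart constant `N = 2`, perturbation letter `c = 1∕5`: the interacting chart's inverse bound is
`(N⁻¹ − c)⁻¹ = 10∕3`. -/
example : ((2 : ℝ)⁻¹ - 1 / 5)⁻¹ = 10 / 3 := by norm_num

/-! ## §8. (v1.1, APPEND) The fluctuation covariance at the background: `C(w) = A(w)⁻¹ ∘ inr`, its fibre equation, the sup bound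
`(N⁻¹ − c)⁻¹`, and the background-dependence modulus -/

section FluctuationAbstract

variable {E F K : Type*} [NormedAddCommGroup E] [NormedSpace ℝ E] [NormedAddCommGroup F] [NormedSpace ℝ F]
  [NormedAddCommGroup K] [NormedSpace ℝ K]

/-- For a chart `A h = (Q h, S h)`: the FIBRE RESPONSE `A⁻¹(0, κ)` solves `Q h = 0`, `S h = κ`, and is the only solution. [folklore] -/
theorem fibre_letters (A : E ≃L[ℝ] F × K) (Q : E →L[ℝ] F) (S : E →L[ℝ] K) (hA : ∀ h, A h = (Q h, S h)) (κ : K) :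
    Q (A.symm (0, κ)) = 0 ∧ S (A.symm (0, κ)) = κ ∧ ∀ h : E, Q h = 0 → S h = κ → h = A.symm (0, κ) := by
  have e : A (A.symm (0, κ)) = (0, κ) := A.apply_symm_apply (0, κ)
  rw [hA] at e
  refine ⟨(Prod.ext_iff.1 e).1, (Prod.ext_iff.1 e).2, fun h h1 h2 => ?_⟩
  rw [ContinuousLinearEquiv.eq_symm_apply, hA, h1, h2]

/-- The inverse chart SPLITS into the background response and the fibre response: `A⁻¹(v, κ) = A⁻¹(v, 0) + A⁻¹(0, κ)`. [folklore] -/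
theorem symm_apply_eq_add (A : E ≃L[ℝ] F × K) (v : F) (κ : K) :
    A.symm (v, κ) = A.symm (v, 0) + A.symm (0, κ) := by
  rw [← map_add, Prod.mk_add_mk, add_zero, zero_add]

/-- Sup bound of the fibre response from the inverse letter: `‖A⁻¹ z‖ ≤ N₁‖z‖` ⟹ `‖A⁻¹(0, κ)‖ ≤ N₁‖κ‖` and `‖A⁻¹ ∘ inr‖ ≤ N₁`.
[folklore] -/
theorem norm_symm_inr_le (A : E ≃L[ℝ] F × K) {N₁ : ℝ} (hN0 : 0 ≤ N₁) (hN : ∀ z : F × K, ‖A.symm z‖ ≤ N₁ * ‖z‖) :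
    (∀ κ : K, ‖A.symm (0, κ)‖ ≤ N₁ * ‖κ‖) ∧
      ‖(A.symm : F × K →L[ℝ] E).comp (ContinuousLinearMap.inr ℝ F K)‖ ≤ N₁ := by
  have h : ∀ κ : K, ‖A.symm (0, κ)‖ ≤ N₁ * ‖κ‖ := fun κ => by
    have h1 := hN (0, κ)
    rwa [Prod.norm_mk, norm_zero, max_eq_right (norm_nonneg κ)] at h1
  exact ⟨h, ContinuousLinearMap.opNorm_le_bound _ hN0 fun κ => h κ⟩

/-- Two charts reading the SAME kept map, `A h = (Q h, S h)` and `B h = (Q h, S′ h)`: `‖B − A‖ ≤ ‖S′ − S‖`. [folklore] -/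
theorem norm_coe_sub_coe_le (A B : E ≃L[ℝ] F × K) (Q : E →L[ℝ] F) (S S' : E →L[ℝ] K) (hA : ∀ h, A h = (Q h, S h))
    (hB : ∀ h, B h = (Q h, S' h)) : ‖(B : E →L[ℝ] F × K) - (A : E →L[ℝ] F × K)‖ ≤ ‖S' - S‖ := by
  refine ContinuousLinearMap.opNorm_le_bound _ (norm_nonneg _) fun h => ?_
  rw [sub_apply, ContinuousLinearEquiv.coe_coe, ContinuousLinearEquiv.coe_coe, hA, hB, Prod.mk_sub_mk, sub_self,
    Prod.norm_mk, norm_zero, max_eq_right (norm_nonneg _), ← sub_apply]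
  exact (S' - S).le_opNorm h

/-- **BACKGROUND-DEPENDENCE MODULUS OF THE FIBRE RESPONSE.**  Two charts on the same kept map with inverse letters `N₁`:
`‖A⁻¹(0, κ) − B⁻¹(0, κ)‖ ≤ N₁²·‖S′ − S‖·‖κ‖` (HSBDM `norm_symm_sub_symm_apply_le` BY NAME). [folklore] -/
theorem norm_symm_inr_sub_le (A B : E ≃L[ℝ] F × K) (Q : E →L[ℝ] F) (S S' : E →L[ℝ] K) (hA : ∀ h, A h = (Q h, S h))
    (hB : ∀ h, B h = (Q h, S' h)) {N₁ : ℝ} (hN0 : 0 ≤ N₁) (hNA : ∀ z : F × K, ‖A.symm z‖ ≤ N₁ * ‖z‖)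
    (hNB : ∀ z : F × K, ‖B.symm z‖ ≤ N₁ * ‖z‖) (κ : K) :
    ‖A.symm (0, κ) - B.symm (0, κ)‖ ≤ N₁ ^ 2 * ‖S' - S‖ * ‖κ‖ := by
  have h := HardStepBranchDerivModulus.norm_symm_sub_symm_apply_le A B hN0 hNA hNB (0, κ)
  rw [Prod.norm_mk, norm_zero, max_eq_right (norm_nonneg κ)] at h
  exact h.trans (mul_le_mul_of_nonneg_right
    (mul_le_mul_of_nonneg_left (norm_coe_sub_coe_le A B Q S S' hA hB) (sq_nonneg _)) (norm_nonneg _))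

end FluctuationAbstract

/-- The Nemytskii derivative family's MODULUS from its displayed action: `N′φ h i = u′(φ i)·h i` and `Lip u′ ≤ L` give
`‖N′φ − N′ψ‖ ≤ L‖φ − ψ‖`. [folklore] -/
theorem norm_nemytskiiDeriv_sub_le
    {N' : lp (fun _ : ι => ℝ) ∞ → (lp (fun _ : ι => ℝ) ∞ →L[ℝ] lp (fun _ : ι => ℝ) ∞)} {u' : ℝ → ℝ}
    (hN' : ∀ (φ h : lp (fun _ : ι => ℝ) ∞) (i : ι), N' φ h i = u' (φ i) * h i) {L : ℝ} (hL0 : 0 ≤ L)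
    (hL : ∀ s t, |u' s - u' t| ≤ L * |s - t|) (φ ψ : lp (fun _ : ι => ℝ) ∞) : ‖N' φ - N' ψ‖ ≤ L * ‖φ - ψ‖ := by
  refine ContinuousLinearMap.opNorm_le_bound _ (mul_nonneg hL0 (norm_nonneg _)) fun h => ?_
  refine lp.norm_le_of_forall_le (mul_nonneg (mul_nonneg hL0 (norm_nonneg _)) (norm_nonneg _)) fun i => ?_
  rw [Real.norm_eq_abs, sub_apply, lp.coeFn_sub, Pi.sub_apply, hN', hN', ← sub_mul, abs_mul]
  refine mul_le_mul ((hL _ _).trans (mul_le_mul_of_nonneg_left ?_ hL0)) (LocalNemytskiiSup.abs_apply_le_norm h i)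
    (abs_nonneg _) (mul_nonneg hL0 (norm_nonneg _))
  rw [← Pi.sub_apply, ← lp.coeFn_sub]
  exact LocalNemytskiiSup.abs_apply_le_norm (φ - ψ) i

section FluctuationInstance

variable {F K : Type*} [NormedAddCommGroup F] [NormedSpace ℝ F] [NormedAddCommGroup K] [NormedSpace ℝ K]

/-- **THE FLUCTUATION COVARIANCE AT THE BACKGROUND CONFIGURATION, IN THE SUP CURRENCY.**  Under the hypotheses of
`exists_smallField_chart_at_background`: its letters (`N`, `N′` with the modulus `‖N′φ − N′ψ‖ ≤ L‖φ − ψ‖`, `σ` with (58) §4's letters)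
AND a family `C : F → (K →L ℓ^∞)` such that at every interior `‖w‖ < (N⁻¹ − c)·r`: `Q(C(w)κ) = 0` and
`R(C(w)κ) + P(N′(σ w)(C(w)κ)) = κ` — `C(w)κ` is THE solution of the fibre equation of the linearised interacting action at the background
(uniqueness displayed) —, **`‖C(w)κ‖ ≤ (N⁻¹ − c)⁻¹‖κ‖`**, `‖C(w)‖ ≤ (N⁻¹ − c)⁻¹`, `C(w) = A(w)⁻¹ ∘ inr` next to `Dσ(w) = A(w)⁻¹ ∘ inl` for
the interacting chart `A(w) h = (Q h, R h + P(N′(σ w) h))`; and on the interior ball the background-dependence modulus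
**`‖C(w)κ − C(w′)κ‖ ≤ (N⁻¹ − c)⁻³·(C_P·L)·‖w − w′‖·‖κ‖`** (§8's abstract letters + σ's Lipschitz letter + the Nemytskii modulus).
[folklore] -/
theorem exists_fluctuation_covariance_at_background [Nonempty ι] (Q : lp (fun _ : ι => ℝ) ∞ →L[ℝ] F)
    (R P : lp (fun _ : ι => ℝ) ∞ →L[ℝ] K)
    (T : lp (fun _ : ι => ℝ) ∞ ≃L[ℝ] F × K) (hT : ∀ h, T h = (Q h, R h)) {N c CP lam : ℝ≥0}
    (hN : ∀ y : F × K, ‖T.symm y‖ ≤ N * ‖y‖) (hP : ‖P‖ ≤ CP) (hc : CP * lam ≤ c) (hcN : c < N⁻¹)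
    {u u' : ℝ → ℝ} (hu : ∀ t, HasDerivAt u (u' t) t) (hu0 : u 0 = 0) (hlam : ∀ t, |u' t| ≤ lam) {L : ℝ} (hL0 : 0 ≤ L)
    (hL : ∀ s t, |u' s - u' t| ≤ L * |s - t|) {r : ℝ} (hr : 0 ≤ r) :
    ∃ (Nu : lp (fun _ : ι => ℝ) ∞ → lp (fun _ : ι => ℝ) ∞)
      (N' : lp (fun _ : ι => ℝ) ∞ → (lp (fun _ : ι => ℝ) ∞ →L[ℝ] lp (fun _ : ι => ℝ) ∞)) (σ : F → lp (fun _ : ι => ℝ) ∞)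
      (C : F → (K →L[ℝ] lp (fun _ : ι => ℝ) ∞)),
      (∀ (φ : lp (fun _ : ι => ℝ) ∞) (i : ι), Nu φ i = u (φ i)) ∧
      (∀ (φ h : lp (fun _ : ι => ℝ) ∞) (i : ι), N' φ h i = u' (φ i) * h i) ∧
      (∀ φ : lp (fun _ : ι => ℝ) ∞, HasFDerivAt Nu (N' φ) φ) ∧
      (∀ φ ψ : lp (fun _ : ι => ℝ) ∞, ‖N' φ - N' ψ‖ ≤ L * ‖φ - ψ‖) ∧ σ 0 = 0 ∧
      (∀ w ∈ closedBall (0 : F) (((N : ℝ)⁻¹ - c) * r),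
        σ w ∈ closedBall 0 r ∧ Q (σ w) = w ∧ R (σ w) + P (Nu (σ w)) = 0) ∧
      LipschitzOnWith (N⁻¹ - c)⁻¹ σ (closedBall (0 : F) (((N : ℝ)⁻¹ - c) * r)) ∧
      (∀ φ ∈ closedBall (0 : lp (fun _ : ι => ℝ) ∞) r, R φ + P (Nu φ) = 0 → σ (Q φ) = φ) ∧
      (∀ w ∈ ball (0 : F) (((N : ℝ)⁻¹ - c) * r),
        (∀ κ : K, Q (C w κ) = 0) ∧ (∀ κ : K, R (C w κ) + P (N' (σ w) (C w κ)) = κ) ∧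
        (∀ (h : lp (fun _ : ι => ℝ) ∞) (κ : K), Q h = 0 → R h + P (N' (σ w) h) = κ → h = C w κ) ∧
        (∀ κ : K, ‖C w κ‖ ≤ ((N : ℝ)⁻¹ - c)⁻¹ * ‖κ‖) ∧ ‖C w‖ ≤ ((N : ℝ)⁻¹ - c)⁻¹ ∧
        ∃ A : lp (fun _ : ι => ℝ) ∞ ≃L[ℝ] F × K,
          (∀ h, A h = (Q h, R h + P (N' (σ w) h))) ∧
          (∀ z : F × K, ‖A.symm z‖ ≤ ((N : ℝ)⁻¹ - c)⁻¹ * ‖z‖) ∧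
          HasFDerivAt σ ((A.symm : F × K →L[ℝ] lp (fun _ : ι => ℝ) ∞).comp (ContinuousLinearMap.inl ℝ F K)) w ∧
          C w = (A.symm : F × K →L[ℝ] lp (fun _ : ι => ℝ) ∞).comp (ContinuousLinearMap.inr ℝ F K)) ∧
      (∀ w ∈ ball (0 : F) (((N : ℝ)⁻¹ - c) * r), ∀ w' ∈ ball (0 : F) (((N : ℝ)⁻¹ - c) * r), ∀ κ : K,
        ‖C w κ - C w' κ‖ ≤ ((N : ℝ)⁻¹ - c)⁻¹ ^ 3 * (CP * L) * ‖w - w'‖ * ‖κ‖) := by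
  classical
  obtain ⟨Nu, N', σ, hNapp, hN'app, hNderiv, hσ0, hσ, hlip, huniq, hchart⟩ :=
    exists_smallField_chart_at_background Q R P T hT hN hP hc hcN hu hu0 hlam hL0 hL hr
  have hmod : ∀ φ ψ : lp (fun _ : ι => ℝ) ∞, ‖N' φ - N' ψ‖ ≤ L * ‖φ - ψ‖ :=
    norm_nemytskiiDeriv_sub_le hN'app hL0 hL
  choose A hAeq hAinv hAd using hchart
  have hcN' : (c : ℝ) < (N : ℝ)⁻¹ := by
    have h := NNReal.coe_lt_coe.2 hcN
    rwa [NNReal.coe_inv] at h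
  have hK0 : (0 : ℝ) ≤ ((N : ℝ)⁻¹ - c)⁻¹ := inv_nonneg.2 (sub_nonneg.2 hcN'.le)
  have hKcoe : (((N⁻¹ - c)⁻¹ : ℝ≥0) : ℝ) = ((N : ℝ)⁻¹ - c)⁻¹ := by
    rw [NNReal.coe_inv, NNReal.coe_sub hcN.le, NNReal.coe_inv]
  -- the interacting chart's second letter `S(w) = R + P ∘ N′(σ w)`
  have hS : ∀ (w : F) (hw : w ∈ ball (0 : F) (((N : ℝ)⁻¹ - c) * r)) (h : lp (fun _ : ι => ℝ) ∞),
      A w hw h = (Q h, (R + P.comp (N' (σ w))) h) := fun w hw h => by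
    rw [hAeq, add_apply, ContinuousLinearMap.comp_apply]
  -- the covariance family, sealed behind its action on the interior ball
  obtain ⟨C, hC⟩ : ∃ C : F → (K →L[ℝ] lp (fun _ : ι => ℝ) ∞),
      ∀ (w : F) (hw : w ∈ ball (0 : F) (((N : ℝ)⁻¹ - c) * r)),
        C w = ((A w hw).symm : F × K →L[ℝ] lp (fun _ : ι => ℝ) ∞).comp (ContinuousLinearMap.inr ℝ F K) :=
    ⟨fun w => if hw : w ∈ ball (0 : F) (((N : ℝ)⁻¹ - c) * r) then
        ((A w hw).symm : F × K →L[ℝ] lp (fun _ : ι => ℝ) ∞).comp (ContinuousLinearMap.inr ℝ F K) else 0,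
      fun w hw => dif_pos hw⟩
  have hCapp : ∀ (w : F) (hw : w ∈ ball (0 : F) (((N : ℝ)⁻¹ - c) * r)) (κ : K), C w κ = (A w hw).symm (0, κ) :=
    fun w hw κ => by rw [hC w hw]; rfl
  refine ⟨Nu, N', σ, C, hNapp, hN'app, hNderiv, hmod, hσ0, hσ, hlip, huniq, fun w hw => ?_, fun w hw w' hw' κ => ?_⟩
  · obtain ⟨hb, hop⟩ := norm_symm_inr_le (A w hw) hK0 (hAinv w hw)
    refine ⟨fun κ => ?_, fun κ => ?_, fun h κ h1 h2 => ?_, fun κ => ?_, ?_, A w hw, hAeq w hw, hAinv w hw, hAd w hw, hC w hw⟩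
    · rw [hCapp w hw]; exact (fibre_letters (A w hw) Q _ (hS w hw) κ).1
    · have e := (fibre_letters (A w hw) Q _ (hS w hw) κ).2.1
      rw [add_apply, ContinuousLinearMap.comp_apply] at e
      rw [hCapp w hw]; exact e
    · rw [hCapp w hw]
      exact (fibre_letters (A w hw) Q _ (hS w hw) κ).2.2 h h1 (by rw [add_apply, ContinuousLinearMap.comp_apply]; exact h2)
    · rw [hCapp w hw]; exact hb κ
    · rw [hC w hw]; exact hop
  · rw [hCapp w hw, hCapp w' hw']
    have h1 := norm_symm_inr_sub_le (A w hw) (A w' hw') Q (R + P.comp (N' (σ w))) (R + P.comp (N' (σ w')))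
      (hS w hw) (hS w' hw') hK0 (hAinv w hw) (hAinv w' hw') κ
    have h3 : ‖σ w' - σ w‖ ≤ ((N : ℝ)⁻¹ - c)⁻¹ * ‖w - w'‖ := by
      rw [norm_sub_rev, ← hKcoe]
      exact hlip.norm_sub_le (ball_subset_closedBall hw) (ball_subset_closedBall hw')
    have h2 : ‖(R + P.comp (N' (σ w'))) - (R + P.comp (N' (σ w)))‖
        ≤ CP * (L * (((N : ℝ)⁻¹ - c)⁻¹ * ‖w - w'‖)) := by
      rw [add_sub_add_left_eq_sub, ← ContinuousLinearMap.comp_sub]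
      exact (ContinuousLinearMap.opNorm_comp_le _ _).trans
        (mul_le_mul hP ((hmod _ _).trans (mul_le_mul_of_nonneg_left h3 hL0)) (norm_nonneg _) CP.coe_nonneg)
    refine h1.trans (le_of_le_of_eq (mul_le_mul_of_nonneg_right
      (mul_le_mul_of_nonneg_left h2 (sq_nonneg _)) (norm_nonneg _)) (by ring))

end FluctuationInstance

/-- Toy for §8: the modulus constant's shape — `N = 2`, `c = 1∕5`, `C_P = 2`, `L = 3`: `(N⁻¹ − c)⁻³·(C_P·L) = (10∕3)³·6 = 2000∕9`. -/
example : ((2 : ℝ)⁻¹ - 1 / 5)⁻¹ ^ 3 * (2 * 3) = 2000 / 9 := by norm_num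


end Summit.QuantumFields.BalabanUV.T4Continuum.NE7b.SupInteractingChart

end
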